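import Summits.AtomisticToContinuum.HydrodynamicLimit.Theorems.BoltzmannGreenKubo.Negative.EnergyWitness
import Summits.AtomisticToContinuum.HydrodynamicLimit.Theorems.BoltzmannGreenKubo.Negative.PiStatics
import Summits.AtomisticToContinuum.HydrodynamicLimit.Theorems.BoltzmannGreenKubo.Negative.TimeAverage
import Literature.MathematicalPhysics.KineticTheory.HardSphereBBGKYLiouvilleFlow

/-!
# Mazur's floor against the kinetic ENERGY for deterministic hard spheres (energy-floor helper file 2/3)

`energy_floor`: for every `N`, `σ ≤ 1/2`, `h > 0` and flow `Φ`, under the constant-profile local Gibbs law,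
`E[(h⁻¹∫₀ʰ Σᵢ g_E(vᵢ(r)) dr)²] ≥ (N+1) κ_E`, `κ_E = m_E²(v_q+2)/(v_q+1)² > 0` — the quadratic Cauchy–Schwarz
`0 ≤ E[(A − λQ)²]` at `λ = m_E/(v_q+1)` against the conserved centred kinetic energy `Q = Σ(|vᵢ|² − 3) = 2E − 3(N+1)`
(`QE_flow`, energy conservation), with `E[A Q] = E[F_E Q] = (N+1) m_E` (Fubini + stationarity, file TimeAverage) and
`E[Q²] = (N+1) v_q`; cross terms between particles vanish by CENTRING + independence (`integral_sum_mul_sum_of_centred`).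
refuter-cdisprove-stmt-AtomisticToContinuum-13985-0 (crux BoltzmannGreenKubo, stmt-13985; see `Cruxes/BoltzmannGreenKubo/Disproof.lean` §1i).
-/

noncomputable section

namespace Summit.AtomisticToContinuum.HydrodynamicLimit.Theorems

open MeasureTheory ProbabilityTheory Filter Topology Set
open Literature.Analysis.FluidPDE Literature.MathematicalPhysics.KineticTheory
open Literature.Analysis.UnboundedOperators
open scoped InnerProductSpace
open BoltzmannGreenKuboForallN

namespace BoltzmannGreenKuboOrthMomentum

section EnergyFloor

variable {σ : ℝ} {N : ℕ}

/-- Cross terms vanish for CENTRED observables by independence of the particles. [folklore] -/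
theorem integral_cross_eq_zero_of_centred {n : ℕ} (μ : Measure V3) [IsProbabilityMeasure μ]
    (a b : V3 → ℝ) (ha : Measurable a) (hb : Measurable b) (ha0 : ∫ w, a w ∂μ = 0)
    {i j : Fin n} (hij : i ≠ j) :
    ∫ v, a (v i) * b (v j) ∂(Measure.pi fun _ : Fin n => μ) = 0 := by
  have hind : iIndepFun (fun i (v : Fin n → V3) => v i) (Measure.pi fun _ : Fin n => μ) :=
    iIndepFun_pi (X := fun _ => id) fun _ => aemeasurable_id
  have hpair : IndepFun (fun v : Fin n → V3 => a (v i)) (fun v => b (v j)) (Measure.pi fun _ : Fin n => μ) :=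
    (hind.indepFun hij).comp ha hb
  rw [hpair.integral_fun_mul_eq_mul_integral ((ha.comp (measurable_pi_apply i)).aestronglyMeasurable)
    ((hb.comp (measurable_pi_apply j)).aestronglyMeasurable)]
  have : ∫ v : Fin n → V3, a (v i) ∂(Measure.pi fun _ : Fin n => μ) = 0 := by
    rw [integral_diag μ a ha i, ha0]
  rw [this, zero_mul]

/-- `∫ (Σᵢ a(vᵢ))(Σⱼ b(vⱼ)) d(⊗ⁿμ) = n ∫ a b dμ` for `a` centred (independence instead of oddness). [folklore] -/
theorem integral_sum_mul_sum_of_centred {n : ℕ} (μ : Measure V3) [IsProbabilityMeasure μ]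
    (a b : V3 → ℝ) (ha : Measurable a) (hb : Measurable b) (ha0 : ∫ w, a w ∂μ = 0)
    (hab : ∀ i j : Fin n, Integrable (fun v : Fin n → V3 => a (v i) * b (v j)) (Measure.pi fun _ : Fin n => μ)) :
    ∫ v, (∑ i, a (v i)) * (∑ j, b (v j)) ∂(Measure.pi fun _ : Fin n => μ) = n * ∫ w, a w * b w ∂μ := by
  simp_rw [Finset.sum_mul_sum]
  rw [integral_finsetSum _ (fun i _ => integrable_finsetSum _ (fun j _ => hab i j))]
  have hi : ∀ i : Fin n, ∫ v, ∑ j, a (v i) * b (v j) ∂(Measure.pi fun _ : Fin n => μ) = ∫ w, a w * b w ∂μ := by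
    intro i
    rw [integral_finsetSum _ (fun j _ => hab i j)]
    rw [Finset.sum_eq_single i (fun j _ hji => integral_cross_eq_zero_of_centred μ a b ha hb ha0 (Ne.symm hji))
      (fun h => (h (Finset.mem_univ i)).elim)]
    exact integral_diag μ (fun w => a w * b w) (ha.mul hb) i
  simp only [hi, Finset.sum_const, Finset.card_univ, Fintype.card_fin, nsmul_eq_mul]

/-- The energy observable `F_E = Σᵢ g_E(vᵢ)`. [folklore] -/
def FE (w : Config (N + 1) (Fin 3) T3) : ℝ := ∑ i, gE ((w i).2)

/-- The centred kinetic energy `Q = Σᵢ (|vᵢ|² − 3) = 2E − 3(N+1)`. [folklore] -/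
def QE (w : Config (N + 1) (Fin 3) T3) : ℝ := ∑ i, (‖(w i).2‖ ^ 2 - 3)

/-- Helper (see the module docstring). [folklore] -/
theorem measurable_FE : Measurable (FE : Config (N + 1) (Fin 3) T3 → ℝ) := by
  unfold FE
  exact Finset.measurable_sum _ fun i _ => continuous_gE.measurable.comp (measurable_pi_apply i).snd

/-- Helper (see the module docstring). [folklore] -/
theorem abs_FE_le (w : Config (N + 1) (Fin 3) T3) : |FE w| ≤ 1000 * ((N : ℝ) + 1) := by
  unfold FE
  refine (Finset.abs_sum_le_sum_abs _ _).trans ?_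
  calc ∑ i, |gE ((w i).2)| ≤ ∑ _i : Fin (N + 1), (1000 : ℝ) := Finset.sum_le_sum fun i _ => abs_gE_le _
    _ = 1000 * ((N : ℝ) + 1) := by simp [Finset.sum_const, Finset.card_univ, Fintype.card_fin]; ring

/-- Helper (see the module docstring). [folklore] -/
theorem measurable_QE : Measurable (QE : Config (N + 1) (Fin 3) T3 → ℝ) := by
  unfold QE
  refine Finset.measurable_sum _ fun i _ => ?_
  exact ((measurable_pi_apply i).snd.norm.pow_const 2).sub measurable_const

/-- Helper (see the module docstring). [folklore] -/
theorem QE_eq_configEnergy (w : Config (N + 1) (Fin 3) T3) : QE w = 2 * configEnergy w - 3 * ((N : ℝ) + 1) := by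
  simp only [QE, configEnergy, Finset.sum_sub_distrib, Finset.sum_const, Finset.card_univ, Fintype.card_fin,
    nsmul_eq_mul]
  push_cast
  ring

/-- `Q` is conserved on the good set (energy conservation). [folklore] -/
theorem QE_flow (Φ : HardSphereFlow (Torus.geometry (Fin 3)) (hsDiameter σ N) (N + 1))
    {z : Config (N + 1) (Fin 3) T3} (hz : z ∈ Φ.good) (t : ℝ) : QE (Φ.flow t z) = QE z := by
  rw [QE_eq_configEnergy, QE_eq_configEnergy, Φ.configEnergy_flow hz t]

/-- Helper (see the module docstring). [folklore] -/
theorem FE_eq_velOf (w : Config (N + 1) (Fin 3) T3) : FE w = (fun v : Fin (N + 1) → V3 => ∑ i, gE (v i)) (velOf w) := rfl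

/-- Helper (see the module docstring). [folklore] -/
theorem QE_eq_velOf (w : Config (N + 1) (Fin 3) T3) :
    QE w = (fun v : Fin (N + 1) → V3 => ∑ i, (‖v i‖ ^ 2 - 3)) (velOf w) := rfl

/-- Helper (see the module docstring). [folklore] -/
theorem QE_eq_velOf' : (QE : Config (N + 1) (Fin 3) T3 → ℝ) =
    fun w => (fun v : Fin (N + 1) → V3 => ∑ i, (‖v i‖ ^ 2 - 3)) (velOf w) := rfl

/-- Helper (see the module docstring). [folklore] -/
theorem measurable_qE : Measurable fun v : V3 => ‖v‖ ^ 2 - 3 := (measurable_norm.pow_const 2).sub measurable_const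

/-- Helper (see the module docstring). [folklore] -/
theorem integrable_qE : Integrable (fun v : V3 => ‖v‖ ^ 2 - 3) (stdGaussian V3) :=
  integrable_norm_sq_stdGaussian.sub (integrable_const _)

/-- Helper (see the module docstring). [folklore] -/
theorem integral_qE : ∫ v : V3, (‖v‖ ^ 2 - 3) ∂stdGaussian V3 = 0 := by
  rw [integral_sub (f := fun v : V3 => ‖v‖ ^ 2) (g := fun _ => (3 : ℝ)) integrable_norm_sq_stdGaussian (integrable_const _),
    integral_norm_sq_stdGaussian]
  simp

/-- Helper (see the module docstring). [folklore] -/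
theorem integrable_qE_sq : Integrable (fun v : V3 => (‖v‖ ^ 2 - 3) ^ 2) (stdGaussian V3) := by
  have e : (fun v : V3 => (‖v‖ ^ 2 - 3) ^ 2) = fun v => (‖v‖ ^ 4 - 6 * ‖v‖ ^ 2) + 9 := by
    funext v; ring
  have h1 : Integrable (fun v : V3 => ‖v‖ ^ 4 - 6 * ‖v‖ ^ 2) (stdGaussian V3) :=
    integrable_norm_pow_four_stdGaussian.sub (integrable_norm_sq_stdGaussian.const_mul 6)
  rw [e]
  exact h1.add (integrable_const 9)

/-- Helper (see the module docstring). [folklore] -/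
theorem integrable_pi_gE_qE (i j : Fin (N + 1)) :
    Integrable (fun v : Fin (N + 1) → V3 => gE (v i) * (‖v j‖ ^ 2 - 3)) (Measure.pi fun _ : Fin (N + 1) => stdGaussian V3) := by
  have hj : Integrable (fun v : Fin (N + 1) → V3 => ‖v j‖ ^ 2 - 3) (Measure.pi fun _ : Fin (N + 1) => stdGaussian V3) :=
    ((measurePreserving_eval (fun _ : Fin (N + 1) => stdGaussian V3) j).integrable_comp
      integrable_qE.aestronglyMeasurable).2 integrable_qE
  exact hj.bdd_mul (c := 1000) ((continuous_gE.measurable.comp (measurable_pi_apply i)).aestronglyMeasurable)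
    (Eventually.of_forall fun v => by rw [Real.norm_eq_abs]; exact abs_gE_le _)

/-- Helper (see the module docstring). [folklore] -/
theorem integrable_pi_qE_qE (i j : Fin (N + 1)) :
    Integrable (fun v : Fin (N + 1) → V3 => (‖v i‖ ^ 2 - 3) * (‖v j‖ ^ 2 - 3)) (Measure.pi fun _ : Fin (N + 1) => stdGaussian V3) := by
  have hsq : ∀ k : Fin (N + 1), Integrable (fun v : Fin (N + 1) → V3 => (‖v k‖ ^ 2 - 3) ^ 2)
      (Measure.pi fun _ : Fin (N + 1) => stdGaussian V3) := fun k =>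
    ((measurePreserving_eval (fun _ : Fin (N + 1) => stdGaussian V3) k).integrable_comp
      integrable_qE_sq.aestronglyMeasurable).2 integrable_qE_sq
  have hdom : Integrable (fun v : Fin (N + 1) → V3 => ((‖v i‖ ^ 2 - 3) ^ 2 + (‖v j‖ ^ 2 - 3) ^ 2) / 2)
      (Measure.pi fun _ : Fin (N + 1) => stdGaussian V3) := ((hsq i).add (hsq j)).div_const 2
  refine hdom.mono' (((measurable_qE.comp (measurable_pi_apply i)).mul (measurable_qE.comp (measurable_pi_apply j))).aestronglyMeasurable)
    (Eventually.of_forall fun v => ?_)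
  rw [Real.norm_eq_abs, abs_mul]
  nlinarith [sq_nonneg (|‖v i‖ ^ 2 - 3| - |‖v j‖ ^ 2 - 3|), sq_abs (‖v i‖ ^ 2 - 3), sq_abs (‖v j‖ ^ 2 - 3),
    abs_nonneg (‖v i‖ ^ 2 - 3), abs_nonneg (‖v j‖ ^ 2 - 3)]

/-- `E_{G_N}[F_E Q] = (N+1) m_E`. [folklore] -/
theorem integral_FE_mul_QE (hσ : σ ≤ 1 / 2)
    (Φ : HardSphereFlow (Torus.geometry (Fin 3)) (hsDiameter σ N) (N + 1)) :
    ∫ z, FE z * QE z ∂(localGibbsLaw σ (fun _ => 1) (fun _ => 0) (fun _ => 1) N Φ) = ((N : ℝ) + 1) * mE := by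
  have hH : Measurable fun v : Fin (N + 1) → V3 => (∑ i, gE (v i)) * (∑ j, (‖v j‖ ^ 2 - 3)) :=
    (Finset.measurable_sum _ fun i _ => continuous_gE.measurable.comp (measurable_pi_apply i)).mul
      (Finset.measurable_sum _ fun j _ => measurable_qE.comp (measurable_pi_apply j))
  have h1 := integral_velOf_localGibbsLaw hσ N Φ hH
  simp only [FE_eq_velOf, QE_eq_velOf]
  rw [h1, integral_sum_mul_sum_of_centred (stdGaussian V3) gE (fun v => ‖v‖ ^ 2 - 3) continuous_gE.measurable
    measurable_qE integral_gE integrable_pi_gE_qE]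
  rw [mE]
  push_cast
  ring

/-- `E_{G_N}[Q²] = (N+1) v_q`, `v_q = E γ[(|w|² − 3)²]`. [folklore] -/
theorem integral_QE_sq (hσ : σ ≤ 1 / 2)
    (Φ : HardSphereFlow (Torus.geometry (Fin 3)) (hsDiameter σ N) (N + 1)) :
    ∫ z, QE z * QE z ∂(localGibbsLaw σ (fun _ => 1) (fun _ => 0) (fun _ => 1) N Φ) =
      ((N : ℝ) + 1) * ∫ v : V3, (‖v‖ ^ 2 - 3) * (‖v‖ ^ 2 - 3) ∂stdGaussian V3 := by
  have hH : Measurable fun v : Fin (N + 1) → V3 => (∑ i, (‖v i‖ ^ 2 - 3)) * (∑ j, (‖v j‖ ^ 2 - 3)) :=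
    (Finset.measurable_sum _ fun j _ => measurable_qE.comp (measurable_pi_apply j)).mul
      (Finset.measurable_sum _ fun j _ => measurable_qE.comp (measurable_pi_apply j))
  have h1 := integral_velOf_localGibbsLaw hσ N Φ hH
  simp only [QE_eq_velOf]
  rw [h1, integral_sum_mul_sum_of_centred (stdGaussian V3) (fun v => ‖v‖ ^ 2 - 3) (fun v => ‖v‖ ^ 2 - 3)
    measurable_qE measurable_qE integral_qE integrable_pi_qE_qE]
  push_cast
  ring

/-- Helper (see the module docstring). [folklore] -/
theorem integrable_QE (hσ : σ ≤ 1 / 2)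
    (Φ : HardSphereFlow (Torus.geometry (Fin 3)) (hsDiameter σ N) (N + 1)) :
    Integrable (QE : Config (N + 1) (Fin 3) T3 → ℝ) (localGibbsLaw σ (fun _ => 1) (fun _ => 0) (fun _ => 1) N Φ) := by
  rw [QE_eq_velOf']
  refine integrable_velOf_localGibbsLaw hσ N Φ (H := fun v : Fin (N + 1) → V3 => ∑ i, (‖v i‖ ^ 2 - 3)) ?_
  refine integrable_finsetSum (μ := Measure.pi fun _ : Fin (N + 1) => stdGaussian V3) Finset.univ
    (f := fun (i : Fin (N + 1)) (v : Fin (N + 1) → V3) => ‖v i‖ ^ 2 - 3) fun i _ => ?_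
  exact ((measurePreserving_eval (fun _ : Fin (N + 1) => stdGaussian V3) i).integrable_comp
    integrable_qE.aestronglyMeasurable).2 integrable_qE

/-- Helper (see the module docstring). [folklore] -/
theorem integrable_QE_sq (hσ : σ ≤ 1 / 2)
    (Φ : HardSphereFlow (Torus.geometry (Fin 3)) (hsDiameter σ N) (N + 1)) :
    Integrable (fun z : Config (N + 1) (Fin 3) T3 => QE z * QE z)
      (localGibbsLaw σ (fun _ => 1) (fun _ => 0) (fun _ => 1) N Φ) := by
  simp only [QE_eq_velOf]
  refine integrable_velOf_localGibbsLaw hσ N Φ (H := fun v => (∑ i, (‖v i‖ ^ 2 - 3)) * (∑ j, (‖v j‖ ^ 2 - 3))) ?_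
  have e : (fun v : Fin (N + 1) → V3 => (∑ i, (‖v i‖ ^ 2 - 3)) * (∑ j, (‖v j‖ ^ 2 - 3))) =
      fun v => ∑ i, ∑ j, (‖v i‖ ^ 2 - 3) * (‖v j‖ ^ 2 - 3) := by
    funext v
    rw [Finset.sum_mul_sum]
  rw [e]
  refine integrable_finsetSum (μ := Measure.pi fun _ : Fin (N + 1) => stdGaussian V3) Finset.univ
    (f := fun (i : Fin (N + 1)) (v : Fin (N + 1) → V3) => ∑ j, (‖v i‖ ^ 2 - 3) * (‖v j‖ ^ 2 - 3)) fun i _ => ?_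
  exact integrable_finsetSum (μ := Measure.pi fun _ : Fin (N + 1) => stdGaussian V3) Finset.univ
    (f := fun (j : Fin (N + 1)) (v : Fin (N + 1) → V3) => (‖v i‖ ^ 2 - 3) * (‖v j‖ ^ 2 - 3)) fun j _ => integrable_pi_qE_qE i j

/-- Helper (see the module docstring). [folklore] -/
theorem integrable_FE (Φ : HardSphereFlow (Torus.geometry (Fin 3)) (hsDiameter σ N) (N + 1))
    [IsProbabilityMeasure (localGibbsLaw σ (fun _ => 1) (fun _ => 0) (fun _ => 1) N Φ)] :
    Integrable (FE : Config (N + 1) (Fin 3) T3 → ℝ) (localGibbsLaw σ (fun _ => 1) (fun _ => 0) (fun _ => 1) N Φ) :=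
  (integrable_const (1000 * ((N : ℝ) + 1))).mono' measurable_FE.aestronglyMeasurable
    (Eventually.of_forall fun w => by rw [Real.norm_eq_abs]; exact abs_FE_le w)

/-- Helper (see the module docstring). [folklore] -/
theorem integrable_FE_mul_QE (hσ : σ ≤ 1 / 2)
    (Φ : HardSphereFlow (Torus.geometry (Fin 3)) (hsDiameter σ N) (N + 1)) :
    Integrable (fun z : Config (N + 1) (Fin 3) T3 => FE z * QE z)
      (localGibbsLaw σ (fun _ => 1) (fun _ => 0) (fun _ => 1) N Φ) :=
  (integrable_QE hσ Φ).bdd_mul (c := 1000 * ((N : ℝ) + 1)) measurable_FE.aestronglyMeasurable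
    (Eventually.of_forall fun w => by rw [Real.norm_eq_abs]; exact abs_FE_le w)

/-- The floor constant `κ = m_E²(v_q + 2)/(v_q + 1)² > 0`. [folklore] -/
def kappaE : ℝ := mE ^ 2 * ((∫ v : V3, (‖v‖ ^ 2 - 3) * (‖v‖ ^ 2 - 3) ∂stdGaussian V3) + 2) /
  ((∫ v : V3, (‖v‖ ^ 2 - 3) * (‖v‖ ^ 2 - 3) ∂stdGaussian V3) + 1) ^ 2

/-- Helper (see the module docstring). [folklore] -/
theorem vq_nonneg : 0 ≤ ∫ v : V3, (‖v‖ ^ 2 - 3) * (‖v‖ ^ 2 - 3) ∂stdGaussian V3 :=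
  integral_nonneg fun _ => mul_self_nonneg _

/-- Helper (see the module docstring). [folklore] -/
theorem kappaE_pos : 0 < kappaE := by
  have hm : 0 < mE := lt_of_lt_of_le one_pos one_le_mE
  have hv := vq_nonneg
  unfold kappaE
  positivity

/-- **MAZUR'S FLOOR AGAINST THE ENERGY** (finite `N`, mechanised): the window average `A` of `F_E = Σ g_E(vᵢ)` has
`E[A²] ≥ (N+1) κ_E` with `κ_E > 0` — the projection of `F_E` on the conserved kinetic energy is ballistic
(quadratic `0 ≤ E[(A − λQ)²]` at `λ = m_E/(v_q+1)`, `E[A Q] = E[F_E Q]` by Fubini + stationarity + conservation).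
[folklore] -/
theorem energy_floor (hσ : σ ≤ 1 / 2)
    (Φ : HardSphereFlow (Torus.geometry (Fin 3)) (hsDiameter σ N) (N + 1)) {h : ℝ} (hh : 0 < h) :
    ((N : ℝ) + 1) * kappaE ≤
      ∫ z, (h⁻¹ * ∫ r in (0 : ℝ)..h, FE (Φ.flow r z)) ^ 2 ∂(localGibbsLaw σ (fun _ => 1) (fun _ => 0) (fun _ => 1) N Φ) := by
  haveI : IsProbabilityMeasure (localGibbsLaw σ (fun _ => (1 : ℝ)) (fun _ => (0 : V3)) (fun _ => (1 : ℝ)) N Φ) :=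
    isProbabilityMeasure_localGibbsLaw continuous_const continuous_const
      continuous_const (fun _ => one_pos) (fun _ => one_pos) hσ N Φ
  obtain ⟨A, hA⟩ : ∃ A : Config (N + 1) (Fin 3) T3 → ℝ, A = fun z => h⁻¹ * ∫ r in (0 : ℝ)..h, FE (Φ.flow r z) :=
    ⟨_, rfl⟩
  set vq : ℝ := ∫ v : V3, (‖v‖ ^ 2 - 3) * (‖v‖ ^ 2 - 3) ∂stdGaussian V3 with hvq
  have hAbd : ∀ z, |A z| ≤ 1000 * ((N : ℝ) + 1) := by
    intro z
    have hI : ‖∫ r in (0 : ℝ)..h, FE (Φ.flow r z)‖ ≤ 1000 * ((N : ℝ) + 1) * |h - 0| :=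
      intervalIntegral.norm_integral_le_of_norm_le_const fun r _ => by
        rw [Real.norm_eq_abs]; exact abs_FE_le _
    rw [Real.norm_eq_abs, sub_zero, abs_of_pos hh] at hI
    rw [hA, abs_mul, abs_inv, abs_of_pos hh]
    calc h⁻¹ * |∫ r in (0 : ℝ)..h, FE (Φ.flow r z)| ≤ h⁻¹ * (1000 * ((N : ℝ) + 1) * h) :=
          mul_le_mul_of_nonneg_left hI (by positivity)
      _ = 1000 * ((N : ℝ) + 1) := by field_simp
  have hwin : Integrable (fun z => ∫ r in (0 : ℝ)..h, FE (Φ.flow r z))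
      (localGibbsLaw σ (fun _ => 1) (fun _ => 0) (fun _ => 1) N Φ) :=
    integrable_window 1 1 0 Φ measurable_FE (integrable_FE Φ) hh.le
  have hAm : AEStronglyMeasurable A (localGibbsLaw σ (fun _ => 1) (fun _ => 0) (fun _ => 1) N Φ) := by
    rw [hA]
    exact hwin.aestronglyMeasurable.const_mul _
  have hA2 : Integrable (fun z => A z ^ 2) (localGibbsLaw σ (fun _ => 1) (fun _ => 0) (fun _ => 1) N Φ) := by
    refine (integrable_const ((1000 * ((N : ℝ) + 1)) ^ 2)).mono' (hAm.pow 2) (Eventually.of_forall fun z => ?_)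
    rw [Real.norm_eq_abs, abs_pow]
    exact pow_le_pow_left₀ (abs_nonneg _) (hAbd z) 2
  have hAQ : Integrable (fun z => A z * QE z) (localGibbsLaw σ (fun _ => 1) (fun _ => 0) (fun _ => 1) N Φ) :=
    (integrable_QE hσ Φ).bdd_mul (c := 1000 * ((N : ℝ) + 1)) hAm
      (Eventually.of_forall fun z => by rw [Real.norm_eq_abs]; exact hAbd z)
  have hQ2 := integrable_QE_sq hσ Φ
  have hkey : ∫ z, A z * QE z ∂(localGibbsLaw σ (fun _ => 1) (fun _ => 0) (fun _ => 1) N Φ) = ((N : ℝ) + 1) * mE := by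
    have hae : (fun z => A z * QE z) =ᵐ[localGibbsLaw σ (fun _ => 1) (fun _ => 0) (fun _ => 1) N Φ]
        fun z => h⁻¹ * ∫ r in (0 : ℝ)..h, FE (Φ.flow r z) * QE (Φ.flow r z) := by
      filter_upwards [ae_mem_good_localGibbsLaw' (N := N) 1 1 0 Φ] with z hz
      rw [hA]
      simp only [QE_flow Φ hz]
      rw [intervalIntegral.integral_mul_const, mul_assoc]
    rw [integral_congr_ae hae, integral_const_mul,
      integral_window_eq 1 1 0 Φ (X := fun w => FE w * QE w) (measurable_FE.mul measurable_QE)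
        (integrable_FE_mul_QE hσ Φ) hh.le,
      ← mul_assoc, inv_mul_cancel₀ hh.ne', one_mul, integral_FE_mul_QE hσ Φ]
  set lam : ℝ := mE / (vq + 1) with hlam
  have hsq : 0 ≤ ∫ z, (A z - lam * QE z) ^ 2 ∂(localGibbsLaw σ (fun _ => 1) (fun _ => 0) (fun _ => 1) N Φ) :=
    integral_nonneg fun z => sq_nonneg _
  have e : (fun z => (A z - lam * QE z) ^ 2) =
      fun z => (A z ^ 2 - 2 * lam * (A z * QE z)) + lam ^ 2 * (QE z * QE z) := by
    funext z; ring
  have i1 : ∫ z, (A z ^ 2 - 2 * lam * (A z * QE z)) + lam ^ 2 * (QE z * QE z)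
        ∂(localGibbsLaw σ (fun _ => 1) (fun _ => 0) (fun _ => 1) N Φ) =
      ∫ z, (A z ^ 2 - 2 * lam * (A z * QE z)) ∂(localGibbsLaw σ (fun _ => 1) (fun _ => 0) (fun _ => 1) N Φ)
        + ∫ z, lam ^ 2 * (QE z * QE z) ∂(localGibbsLaw σ (fun _ => 1) (fun _ => 0) (fun _ => 1) N Φ) :=
    integral_add (hA2.sub (hAQ.const_mul (2 * lam))) (hQ2.const_mul (lam ^ 2))
  have i2 : ∫ z, (A z ^ 2 - 2 * lam * (A z * QE z)) ∂(localGibbsLaw σ (fun _ => 1) (fun _ => 0) (fun _ => 1) N Φ) =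
      ∫ z, A z ^ 2 ∂(localGibbsLaw σ (fun _ => 1) (fun _ => 0) (fun _ => 1) N Φ)
        - ∫ z, 2 * lam * (A z * QE z) ∂(localGibbsLaw σ (fun _ => 1) (fun _ => 0) (fun _ => 1) N Φ) :=
    integral_sub hA2 (hAQ.const_mul (2 * lam))
  have i3 : ∫ z, 2 * lam * (A z * QE z) ∂(localGibbsLaw σ (fun _ => 1) (fun _ => 0) (fun _ => 1) N Φ) =
      2 * lam * (((N : ℝ) + 1) * mE) := by
    rw [integral_const_mul, hkey]
  have i4 : ∫ z, lam ^ 2 * (QE z * QE z) ∂(localGibbsLaw σ (fun _ => 1) (fun _ => 0) (fun _ => 1) N Φ) =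
      lam ^ 2 * (((N : ℝ) + 1) * vq) := by
    rw [integral_const_mul, integral_QE_sq hσ Φ]
  rw [e, i1, i2, i3, i4] at hsq
  have hAA : ∫ z, A z ^ 2 ∂(localGibbsLaw σ (fun _ => 1) (fun _ => 0) (fun _ => 1) N Φ) =
      ∫ z, (h⁻¹ * ∫ r in (0 : ℝ)..h, FE (Φ.flow r z)) ^ 2 ∂(localGibbsLaw σ (fun _ => 1) (fun _ => 0) (fun _ => 1) N Φ) := by
    rw [hA]
  rw [← hAA]
  -- W ≥ 2 lam (N+1) mE − lam² (N+1) vq = (N+1) mE² (vq+2)/(vq+1)²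
  have hv := vq_nonneg
  rw [← hvq] at hv
  have hk : kappaE = mE ^ 2 * (vq + 2) / (vq + 1) ^ 2 := by rw [kappaE, ← hvq]
  have hv1 : 0 < vq + 1 := by linarith
  have key : ((N : ℝ) + 1) * kappaE = 2 * lam * (((N : ℝ) + 1) * mE) - lam ^ 2 * (((N : ℝ) + 1) * vq) := by
    rw [hk, hlam]
    field_simp
    ring
  linarith [key, hsq]

end EnergyFloor
end BoltzmannGreenKuboOrthMomentum

end Summit.AtomisticToContinuum.HydrodynamicLimit.Theorems

end
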